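import Literature.MathematicalPhysics.QuantumFieldTheory.ConformalBootstrap3D.PointKernelK34v2Data
import Literature.MathematicalPhysics.QuantumFieldTheory.ConformalBootstrap3D.PointKernelParts

/-!
# K34v2 certificate, kernel part file P67: one-cell head segments 174, 175, 176 in level ranges

The head cells whose kernel evaluation exceeds one `decide` are one-cell segments of `hsegsK34v2`; each is
checked by `PCert.hPartSideOK` (side conditions) and `PCert.hPartOK` per level range `[n_lo, n_lo + count)`
against an integer claim, the claims summing to `≥ 0` (`PointKernel.partsOK`); soundness is
`PCert.hParts_sound` (`PointKernelParts`).  The part files `P1, P2, …` are mutually independent (each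
imports only the data file); the ranges of one cell may span several of them, and the per-cell
conclusions `hparts_i` / `hcell_i` of those cells are assembled in `PointKernelK34v2.lean`.
Estimated kernel time 254 s.
-/

set_option maxRecDepth 100000
set_option maxHeartbeats 0

namespace Literature.MathematicalPhysics.QuantumFieldTheory.ConformalBootstrap3D.PointKernelK34v2

open Literature.MathematicalPhysics.QuantumFieldTheory.ConformalBootstrap3D.PointKernel

/-- levels `[31, 44)` of segment 174: partial lower sum `≥` claim. [folklore] -/
theorem part_174_1 : certK34v2.hPartOK (PCert.segAt hsegsK34v2 174) JHK34v2 31 13 (17085714336738110231364778985450389799) = true := by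
  decide +kernel

/-- levels `[44, 49)` of segment 174: partial lower sum `≥` claim. [folklore] -/
theorem part_174_2 : certK34v2.hPartOK (PCert.segAt hsegsK34v2 174) JHK34v2 44 5 (1545373889784312895815821824683372584) = true := by
  decide +kernel

/-- one-cell segment 175 (row 6, cell `[1805/256, 903/128]`, chord, `n_F = 48`,
3 level ranges): side conditions. [folklore] -/
theorem pside_175 : certK34v2.hPartSideOK (PCert.segAt hsegsK34v2 175) JHK34v2 = true := by
  decide +kernel

/-- its level ranges `(n_lo, count, claim)`. [folklore] -/
def parts_175 : List (ℕ × ℕ × ℤ) := [(0, 31, -17945614066921183277483528410667653719), (31, 13, 16762547784307592789781354988972220394), (44, 5, 1183066282613590487702173421695433325)]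

/-- the ranges tile `[0, n_F]` and the claims sum to `≥ 0`. [folklore] -/
theorem pcov_175 : PointKernel.partsOK 48 parts_175 = true := by
  decide +kernel

/-- levels `[0, 31)` of segment 175: partial lower sum `≥` claim. [folklore] -/
theorem part_175_0 : certK34v2.hPartOK (PCert.segAt hsegsK34v2 175) JHK34v2 0 31 (-17945614066921183277483528410667653719) = true := by
  decide +kernel

/-- levels `[31, 44)` of segment 175: partial lower sum `≥` claim. [folklore] -/
theorem part_175_1 : certK34v2.hPartOK (PCert.segAt hsegsK34v2 175) JHK34v2 31 13 (16762547784307592789781354988972220394) = true := by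
  decide +kernel

/-- levels `[44, 49)` of segment 175: partial lower sum `≥` claim. [folklore] -/
theorem part_175_2 : certK34v2.hPartOK (PCert.segAt hsegsK34v2 175) JHK34v2 44 5 (1183066282613590487702173421695433325) = true := by
  decide +kernel

/-- one-cell segment 176 (row 6, cell `[903/128, 1807/256]`, chord, `n_F = 40`,
2 level ranges): side conditions. [folklore] -/
theorem pside_176 : certK34v2.hPartSideOK (PCert.segAt hsegsK34v2 176) JHK34v2 = true := by
  decide +kernel

/-- its level ranges `(n_lo, count, claim)`. [folklore] -/
def parts_176 : List (ℕ × ℕ × ℤ) := [(0, 32, -13362232103202956544871410398773267117), (32, 9, 13362232103202956544871410398773267117)]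

/-- the ranges tile `[0, n_F]` and the claims sum to `≥ 0`. [folklore] -/
theorem pcov_176 : PointKernel.partsOK 40 parts_176 = true := by
  decide +kernel

end Literature.MathematicalPhysics.QuantumFieldTheory.ConformalBootstrap3D.PointKernelK34v2
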